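import Summits.AnomalousDissipation.AnomalousDissipation.Theorems.SawtoothPulseCascadeK1LocalisedCascadeKHSheetBands
import Summits.AnomalousDissipation.AnomalousDissipation.Theorems.SawtoothPulseCascadeK1LocalisedCascadeKHSheetStableTable

/-!
# K2 lane (route-2 `SawtoothPulseCascade`, crux dir `K1LocalisedCascade`): S2 band table — the two ends of the wavenumber axis

Helper file of the K2 lane (S2 certificate, recipe R1–R3 of memo `Cruxes/K1LocalisedCascade/K2SheetBlockPropagator.md`; ACL item
stmt-AnomalousDissipation-19491). The band lemma `sheet_energy_le_on_band` needs `klo > 0` and a short-wave cut-off; the two ends are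
closed analytically here:
* `sheet_energy_le_small_of` — LONG WAVES `0 < k ≤ kmax`: with `x = πk`, `sinh x ≥ x` gives `cosh² x − 1 ≥ x²` and `D(x) ≥ 2 − cosh x`,
  so `σ² ≤ (1 − (2 − Chi)²)/4` and `k²W ≤ (1 + Chi²)/4` for any `Chi ≥ cosh(π kmax)`, `Chi < 2`; then the same bookkeeping as on a band.
* `sheet_energy_le_large_of` — SHORT WAVES `k ≥ kmin` with `D(π kmin) ≤ Dhi < −1`: then `D² > 1 ≥ cos²πβ`, the sheet block is STABLE
  (`c² = (π²/4)(D² − cos²)/(cosh² − cos²) > 0`) and `2W/c² = 2(D² + cos²)/(D² − cos²) ≤ 2(Dhi² + 1)/(Dhi² − 1) ≤ B²`, so the conserved-energy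
  table `sheet_energy_le_of_stable_bound` applies on every horizon.
No definitions; no statement about the crux. [cite: Drazin2002, §8.3 (8.36)–(8.38)] [problem: turb]
-/

-- `Summit.<Summit>.<Problem>`: single-conjunct summit, the duplicate namespace segment is deliberate.
set_option linter.dupNamespace false

noncomputable section

namespace Summit.AnomalousDissipation.AnomalousDissipation.Theorems.SawtoothPulseCascade.K2PhaseBudget

open Set Real Complex Literature.Analysis.FluidPDE.SawtoothCascade

/-! ## §1 Long waves -/

/-- **Long-wave end.** For `0 < k ≤ kmax` with `cosh(π kmax) ≤ Chi < 2`: every S2-stub solution on `[0, 8]` and every Bloch phase obey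
`khForm(q θ) ≤ B² khForm(q 0)`, given a rate bound `σb` with `(1 − (2 − Chi)²)/4 ≤ σb²`, `e^{8σb} ≤ U ≤ 2Tσb`, `8 ≤ T`, a weight
`Kw ≥ (1 + Chi²)/4`, and the check `2((U+1)/2)² + 2T²Kw ≤ B²`. [cite: Drazin2002, §8.3 (8.36)–(8.38)] -/
theorem sheet_energy_le_small_of {k β B kmax xhi Chi σb U T Kw : ℝ} (hk : 0 < k) (hk2 : k ≤ kmax)
    (hxhi : 3.141593 * kmax ≤ xhi) (hChi : Real.cosh xhi ≤ Chi) (hChi2 : Chi < 2)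
    (hσb : 0 < σb) (hσ : (1 - (2 - Chi) ^ 2) / 4 ≤ σb ^ 2) (hU : Real.exp (8 * σb) ≤ U) (hTU : U ≤ 2 * T * σb)
    (hT8 : 8 ≤ T) (hKw : (1 + Chi ^ 2) / 4 ≤ Kw) (hB : 2 * ((U + 1) / 2) ^ 2 + 2 * T ^ 2 * Kw ≤ B ^ 2)
    {p S : ℂ} {m : ℝ} {F : (Fin 2 → ℂ) → (Fin 2 → ℂ)}
    (hp : p = ((π / 2 + 2 * sawSigma0 k β : ℝ) : ℂ)) (hS : S = sawS k β) (hm : m = -sawSigma0 k β)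
    (hF : F = fun v => ![I * k * (-p * v 0 - 2 * S * v 1), I * k * (2 * (starRingEnd ℂ) S * v 0 + p * v 1)])
    {q : ℝ → (Fin 2 → ℂ)} (hq : ∀ θ ∈ Icc (0 : ℝ) 8, HasDerivWithinAt q (F (q θ)) (Icc (0 : ℝ) 8) θ) :
    ∀ θ ∈ Icc (0 : ℝ) 8,
      m * (Complex.normSq (q θ 0) + Complex.normSq (q θ 1)) - 2 * ((starRingEnd ℂ) (q θ 0) * S * q θ 1).re ≤
        B ^ 2 * (m * (Complex.normSq (q 0 0) + Complex.normSq (q 0 1)) - 2 * ((starRingEnd ℂ) (q 0 0) * S * q 0 1).re) := by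
  have hπhi := Real.pi_lt_d6
  have hπ0 := Real.pi_pos
  have hx0 : 0 < π * k := by positivity
  have hx2 : π * k ≤ xhi := by
    have h1 : π * k ≤ π * kmax := mul_le_mul_of_nonneg_left hk2 hπ0.le
    have h2 : π * kmax ≤ 3.141593 * kmax := mul_le_mul_of_nonneg_right hπhi.le (hk.le.trans hk2)
    linarith
  -- elementary facts at `x = πk`
  have hCle : Real.cosh (π * k) ≤ Chi := by
    have : Real.cosh (π * k) ≤ Real.cosh xhi := by
      rw [Real.cosh_le_cosh, abs_of_pos hx0, abs_of_nonneg (hx0.le.trans hx2)]; exact hx2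
    exact this.trans hChi
  have hCpos : 0 < Real.cosh (π * k) := Real.cosh_pos _
  have hs : π * k ≤ Real.sinh (π * k) := Real.self_le_sinh_iff.2 hx0.le
  have hC1 : 1 + (π * k) ^ 2 ≤ Real.cosh (π * k) ^ 2 := by
    rw [Real.cosh_sq]; nlinarith [pow_le_pow_left₀ hx0.le hs 2]
  have hDlo : 2 - Real.cosh (π * k) ≤ 2 * Real.sinh (π * k) / (π * k) - Real.cosh (π * k) := by
    have : 2 ≤ 2 * Real.sinh (π * k) / (π * k) := by rw [le_div_iff₀ hx0]; linarith
    linarith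
  have hDC1 : 2 * Real.sinh (π * k) / (π * k) - Real.cosh (π * k) ≤ Real.cosh (π * k) := by
    have h2 : Real.sinh (π * k) ≤ (π * k) * Real.cosh (π * k) := by
      -- termwise on the power series (instance of the tree's `sinh_le_mul_cosh`)
      have e1 := Real.hasSum_sinh (π * k)
      have e2 := (Real.hasSum_cosh (π * k)).mul_left (π * k)
      refine hasSum_le (fun n => ?_) e1 e2
      have hfac : ((2 * n).factorial : ℝ) ≤ ((2 * n + 1).factorial : ℝ) := by exact_mod_cast Nat.factorial_le (by omega)
      have hfpos : (0 : ℝ) < ((2 * n).factorial : ℝ) := by positivity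
      calc (π * k) ^ (2 * n + 1) / ((2 * n + 1).factorial : ℝ)
          ≤ (π * k) ^ (2 * n + 1) / ((2 * n).factorial : ℝ) := div_le_div_of_nonneg_left (by positivity) hfpos hfac
        _ = π * k * ((π * k) ^ (2 * n) / ((2 * n).factorial : ℝ)) := by ring
    have h3 : 2 * Real.sinh (π * k) / (π * k) ≤ 2 * Real.cosh (π * k) := by
      rw [div_le_iff₀ hx0]
      calc 2 * Real.sinh (π * k) ≤ 2 * ((π * k) * Real.cosh (π * k)) := by linarith
        _ = 2 * Real.cosh (π * k) * (π * k) := by ring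
    linarith
  have hcos : Real.cos (π * β) ^ 2 ≤ 1 := by rw [sq_le_one_iff_abs_le_one]; exact Real.abs_cos_le_one _
  have hWD := sheetW_eq_Dform hk β
  have hσsq := sawSigma_sq_eq hk β
  generalize hCx : Real.cosh (π * k) = Cx at hCle hCpos hC1 hDlo hDC1 hWD hσsq
  generalize hDx : 2 * Real.sinh (π * k) / (π * k) - Cx = Dx at hDlo hDC1 hWD hσsq
  have hDC : Dx ^ 2 ≤ Cx ^ 2 := sq_le_sq' (by linarith) hDC1
  have hmDx : (2 - Chi) ^ 2 ≤ Dx ^ 2 := pow_le_pow_left₀ (by linarith) (by linarith) 2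
  have hMDx : Dx ^ 2 ≤ Chi ^ 2 := hDC.trans (pow_le_pow_left₀ hCpos.le hCle 2)
  have hX0 : 0 < (π * k) ^ 2 := by positivity
  have hClo2 : 1 < 1 + (π * k) ^ 2 := by linarith
  -- σ ≤ σb
  have hσ0 : 0 ≤ sawSigma k β := mul_nonneg hk.le (Real.sqrt_nonneg _)
  have hσle : sawSigma k β ≤ σb := by
    have hcheck : (π * k) ^ 2 / 4 * (1 - (2 - Chi) ^ 2) ≤ σb ^ 2 * (1 + (π * k) ^ 2 - 1) := by
      have h := mul_le_mul_of_nonneg_left hσ hX0.le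
      calc (π * k) ^ 2 / 4 * (1 - (2 - Chi) ^ 2) = (π * k) ^ 2 * ((1 - (2 - Chi) ^ 2) / 4) := by ring
        _ ≤ (π * k) ^ 2 * σb ^ 2 := h
        _ = σb ^ 2 * (1 + (π * k) ^ 2 - 1) := by ring
    have hsq : sawSigma k β ^ 2 ≤ σb ^ 2 := by
      rw [hσsq]
      exact sigma_core (x2 := (π * k) ^ 2) hX0.le le_rfl hcos hClo2 hC1 hDC hmDx hcheck
    exact (pow_le_pow_iff_left₀ hσ0 hσb.le two_ne_zero).1 hsq
  -- `k²W ≤ Kw`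
  have hkW : k ^ 2 * (π ^ 2 / 4 * (Dx ^ 2 + Real.cos (π * β) ^ 2) / (Cx ^ 2 - Real.cos (π * β) ^ 2)) ≤ Kw := by
    have e : k ^ 2 * (π ^ 2 / 4 * (Dx ^ 2 + Real.cos (π * β) ^ 2) / (Cx ^ 2 - Real.cos (π * β) ^ 2)) =
        (π * k) ^ 2 / 4 * ((Real.cos (π * β) ^ 2 + Dx ^ 2) / (Cx ^ 2 - Real.cos (π * β) ^ 2)) := by ring
    rw [e]
    have hcheck : (π * k) ^ 2 / 4 * (1 + Chi ^ 2) ≤ Kw * (1 + (π * k) ^ 2 - 1) := by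
      have h := mul_le_mul_of_nonneg_left hKw hX0.le
      calc (π * k) ^ 2 / 4 * (1 + Chi ^ 2) = (π * k) ^ 2 * ((1 + Chi ^ 2) / 4) := by ring
        _ ≤ (π * k) ^ 2 * Kw := h
        _ = Kw * (1 + (π * k) ^ 2 - 1) := by ring
    exact k2W_core (x2 := (π * k) ^ 2) hX0.le le_rfl hcos hClo2 hC1 (sq_nonneg _) hDC hMDx hcheck
  -- bookkeeping and the θ-free reduction
  obtain ⟨hsinh, hcosh⟩ := sinh_cosh_band hσ0 hσle hσb hU hTU
  refine sheet_energy_le_of_sigma_bound (γ := 8) (T := T) hk (by norm_num) hT8 hsinh hp hS hm hF ?_ hq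
  rw [hCx, hWD]
  have h1 : 2 * T ^ 2 * k ^ 2 * (π ^ 2 / 4 * (Dx ^ 2 + Real.cos (π * β) ^ 2) / (Cx ^ 2 - Real.cos (π * β) ^ 2)) ≤
      2 * T ^ 2 * Kw := by
    have := mul_le_mul_of_nonneg_left hkW (show 0 ≤ 2 * T ^ 2 by positivity)
    linarith
  linarith

/-! ## §2 Short waves (the stable end) -/

/-- **Short-wave end.** For `k ≥ kmin > 0` with a certified `D(x_lo) ≤ Dhi < −1` at some `x_lo ≤ π kmin` and `2(Dhi² + 1) ≤ B²(Dhi² − 1)`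
(`2 ≤ B²`): the sheet block is stable for every Bloch phase and every solution on `[0, γ]` obeys `khForm(q θ) ≤ B² khForm(q 0)`.
[cite: Drazin2002, §8.3 (8.36)–(8.38)] -/
theorem sheet_energy_le_large_of {k β γ B kmin xlo Dhi : ℝ} (hk1 : kmin ≤ k) (hkmin : 0 < kmin)
    (hxlo : xlo ≤ 3.141592 * kmin) (hxlo0 : 0 < xlo) (hDhi : 2 * Real.sinh xlo / xlo - Real.cosh xlo ≤ Dhi) (hDhi1 : Dhi < -1)
    (hB2 : 2 ≤ B ^ 2) (hB : 2 * (Dhi ^ 2 + 1) ≤ B ^ 2 * (Dhi ^ 2 - 1))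
    {p S : ℂ} {m : ℝ} {F : (Fin 2 → ℂ) → (Fin 2 → ℂ)}
    (hp : p = ((π / 2 + 2 * sawSigma0 k β : ℝ) : ℂ)) (hS : S = sawS k β) (hm : m = -sawSigma0 k β)
    (hF : F = fun v => ![I * k * (-p * v 0 - 2 * S * v 1), I * k * (2 * (starRingEnd ℂ) S * v 0 + p * v 1)])
    {q : ℝ → (Fin 2 → ℂ)} (hq : ∀ θ ∈ Icc (0 : ℝ) γ, HasDerivWithinAt q (F (q θ)) (Icc (0 : ℝ) γ) θ) :
    ∀ θ ∈ Icc (0 : ℝ) γ,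
      m * (Complex.normSq (q θ 0) + Complex.normSq (q θ 1)) - 2 * ((starRingEnd ℂ) (q θ 0) * S * q θ 1).re ≤
        B ^ 2 * (m * (Complex.normSq (q 0 0) + Complex.normSq (q 0 1)) - 2 * ((starRingEnd ℂ) (q 0 0) * S * q 0 1).re) := by
  have hπlo := Real.pi_gt_d6
  have hπ0 := Real.pi_pos
  have hk : 0 < k := lt_of_lt_of_le hkmin hk1
  have hx0 : 0 < π * k := by positivity
  have hx1 : xlo ≤ π * k := by
    have h1 : 3.141592 * kmin ≤ π * kmin := mul_le_mul_of_nonneg_right hπlo.le hkmin.le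
    have h2 : π * kmin ≤ π * k := mul_le_mul_of_nonneg_left hk1 hπ0.le
    linarith
  have hD1 : 2 * Real.sinh (π * k) / (π * k) - Real.cosh (π * k) ≤ Dhi := (khD_le_khD hxlo0 hx1).trans hDhi
  have hcos : Real.cos (π * β) ^ 2 ≤ 1 := by rw [sq_le_one_iff_abs_le_one]; exact Real.abs_cos_le_one _
  have hden := cosh_sq_sub_cos_sq_pos hk.ne' β
  have hWD := sheetW_eq_Dform hk β
  have hneg := sq_mul_neg_sawC2_eq hk.ne' β
  have hk2 : 0 < k ^ 2 := by positivity
  -- the core inequality `2(D² + cos²) ≤ B²(D² − cos²)` and the sign of `c²`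
  have hD2 : Dhi ^ 2 ≤ (2 * Real.sinh (π * k) / (π * k) - Real.cosh (π * k)) ^ 2 := by
    have h3 : (-Dhi) ^ 2 ≤ (-(2 * Real.sinh (π * k) / (π * k) - Real.cosh (π * k))) ^ 2 :=
      pow_le_pow_left₀ (by linarith) (by linarith) 2
    rw [neg_sq, neg_sq] at h3; exact h3
  have hDhi2 : 1 < Dhi ^ 2 := by nlinarith
  generalize hCx : Real.cosh (π * k) = Cx at hD1 hden hWD hneg hD2
  generalize hDx : 2 * Real.sinh (π * k) / (π * k) - Cx = Dx at hD1 hWD hneg hD2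
  have hcore : 2 * (Dx ^ 2 + Real.cos (π * β) ^ 2) ≤ B ^ 2 * (Dx ^ 2 - Real.cos (π * β) ^ 2) := by
    have h1 : (B ^ 2 - 2) * Dhi ^ 2 ≤ (B ^ 2 - 2) * Dx ^ 2 := mul_le_mul_of_nonneg_left hD2 (by linarith)
    have h2 : (B ^ 2 + 2) * Real.cos (π * β) ^ 2 ≤ (B ^ 2 + 2) * 1 := mul_le_mul_of_nonneg_left hcos (by positivity)
    linarith
  have hc : 0 < sawC2 k β := by
    have hnum : (π * k) ^ 2 / 4 * (Real.cos (π * β) ^ 2 - Dx ^ 2) / (Cx ^ 2 - Real.cos (π * β) ^ 2) < 0 := by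
      apply div_neg_of_neg_of_pos _ hden
      exact mul_neg_of_pos_of_neg (by positivity) (by linarith)
    rw [← hneg] at hnum
    by_contra hc0
    have hc1 : sawC2 k β ≤ 0 := not_lt.1 hc0
    have : 0 ≤ k ^ 2 * -sawC2 k β := mul_nonneg hk2.le (by linarith)
    linarith
  refine sheet_energy_le_of_stable_bound (γ := γ) hk hc hB2 hp hS hm hF ?_ hq
  rw [hCx, hWD]
  have key : 2 * (k ^ 2 * (π ^ 2 / 4 * (Dx ^ 2 + Real.cos (π * β) ^ 2) / (Cx ^ 2 - Real.cos (π * β) ^ 2))) ≤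
      B ^ 2 * (-(k ^ 2 * -sawC2 k β)) := by
    rw [hneg]
    have hfac : 0 ≤ (π * k) ^ 2 / 4 / (Cx ^ 2 - Real.cos (π * β) ^ 2) := by positivity
    calc 2 * (k ^ 2 * (π ^ 2 / 4 * (Dx ^ 2 + Real.cos (π * β) ^ 2) / (Cx ^ 2 - Real.cos (π * β) ^ 2)))
        = 2 * (Dx ^ 2 + Real.cos (π * β) ^ 2) * ((π * k) ^ 2 / 4 / (Cx ^ 2 - Real.cos (π * β) ^ 2)) := by ring
      _ ≤ B ^ 2 * (Dx ^ 2 - Real.cos (π * β) ^ 2) * ((π * k) ^ 2 / 4 / (Cx ^ 2 - Real.cos (π * β) ^ 2)) :=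
          mul_le_mul_of_nonneg_right hcore hfac
      _ = -((π * k) ^ 2 / 4 * (Real.cos (π * β) ^ 2 - Dx ^ 2) / (Cx ^ 2 - Real.cos (π * β) ^ 2)) * B ^ 2 := by ring
      _ = B ^ 2 * -((π * k) ^ 2 / 4 * (Real.cos (π * β) ^ 2 - Dx ^ 2) / (Cx ^ 2 - Real.cos (π * β) ^ 2)) := by ring
  have h2 : k ^ 2 * (2 * (π ^ 2 / 4 * (Dx ^ 2 + Real.cos (π * β) ^ 2) / (Cx ^ 2 - Real.cos (π * β) ^ 2))) ≤
      k ^ 2 * (B ^ 2 * sawC2 k β) := by linarith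
  exact le_of_mul_le_mul_left h2 hk2

end Summit.AnomalousDissipation.AnomalousDissipation.Theorems.SawtoothPulseCascade.K2PhaseBudget

end
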